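/-
Copyright (c) 2026 the pub-hodgecm-mathlib formalisation cell (harness21).  Prover seat hodgecm-mathlib-K2E1-p02 (g5), Track B ∕ K2-LIT,
h413 = `stmt-HodgeConjecture-24833`, line `K2_E1_TraceFormulaBeta`, «EIS-RANK-ONE» rung R6d₂ part (b-i): the GROUP HALF of the dilation bound — along `g = u · t · k` the
big-cell function of `U(J₂)` dilates, `Φ_{utk}(x) = χ(d₁)‖d₁‖^z · Φ_k(Λ(x + x_u))`, `Λ_E = d₀⁻¹d₁`.  2026-09-04.
-/
import Summits.HodgeConjecture.HodgeConjecture.Theorems.K2E1EisensteinMinusConstantTermBoundU2   -- ★ parts (a), (b): the Poisson ∕ dilation bound, hypothesis `hdil`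
import Literature.NumberTheory.Automorphic.UnitaryGroupBorelModulusTwo                            -- ★ `torusConj_middleRootUnipotent_two`, `torus_relations_two`, `conjAdele_torus_two`
import Literature.NumberTheory.AdelicBaseChange.IdeleNormModule                                   -- ★ `ideleNorm_ideleBaseChange` (`‖x_E‖_E = ‖x‖_F^{[E:F]}`)
import HarnessLib

/-!
# h413 ∕ Track B «K2-LIT», «EIS-RANK-ONE» R6d₂ (b-i) — helper `K2E1BigCellLineDilationU2`:
# `Φ_{u t k}(x) = χ(d₁)‖d₁‖_E^z · Φ_k(Λ·(x + x_u))` on `U(J₂)` — the structure hypothesis `hdil` of part (b) from the group law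

Cell `pub/hodgecm-mathlib`, crux H413 = `stmt-HodgeConjecture-24833`, route `HCCMUnconditional`; DEAL «EIS-R6d₂» of the dealer K2E1-plan (g3) 2026-09-04T05:01:15Z,
REPORT-FIRST 05:04:02Z «=» 05:04:18Z; parts (a) ★ p857537, (b) p857572, (b-i) THIS FILE.  THEOREMS ONLY (no `def`, no `instance`, no `notation`, no named-fact hypothesis,
no `sorry`); lane `--kind proof --supports stmt-HodgeConjecture-24833 --as helper` (count-neutral).

THE COMPUTATION (Garrett (2018) §2.9 on `GL₂`; Rogawski (1990) §1.10 for the torus of `U(J₂)`).  With `w₀ = ι(J₂)` (★ `weylLongU`), the line chart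
`n(x) = middleRootUnipotent (traceZeroLine x)` (`x ∈ 𝔸_F`, ★), `u = n(x_u) ∈ N(𝔸_F)`, `t = diag(d₀, d₁) ∈ T(𝔸_F)` (`c(d₀) d₁ = 1`) and any `k`:
`w₀ · n(x) · (u t k) = (w₀ t w₀⁻¹) · w₀ · n(Λ(x + x_u)) · k`, where `w₀ t w₀⁻¹ = diag(d₁, d₀)` and `t⁻¹ n(y) t = n(Λ y)` with `Λ_E = d₀⁻¹ d₁` (★
`torusConj_middleRootUnipotent_two`; `Λ` an idele of `F` with `(Λ)_E = d₀⁻¹d₁` — it is `N_{E/F}(d₀)⁻¹`, §4).  For a Borel section `f` of exponent `z`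
(`f(b g) = χ(b₀₀)‖b₀₀‖_E^z f(g)`, the K2Liu ∕ flat-section law of ★ `flatSectionU_borel_mul_two`) therefore
`Φ_{utk}(x) := f(w₀ n(x) u t k) = χ(d₁)‖d₁‖^z · f(w₀ n(Λ(x + x_u)) k) = m · Φ_k(Λ(x − (−x_u)))` — the hypothesis `hdil` of part (b) with `m = χ(d₁)‖d₁‖_E^z`,
`λ = Λ`, `y = −x_u`; and `‖m‖ = ‖d₁‖_E^σ = |Λ|_F^σ` (`χ` unitary; `|Λ|_F = ‖N d₀‖_F⁻¹ = ‖d₀‖_E⁻¹ = ‖d₁‖_E`) is the hypothesis `hm`.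

* §1 `chart_add` (`n(x + x') = n(x) n(x')`), `torus_inv_mul_chart_mul_torus` (`t⁻¹ n(x) t = n(Λ x)` given `(Λ)_E = d₀⁻¹ d₁`), `weylLongU_mul_weylLongU_two` (`w₀² = 1`),
  `weylLong_conj_torus_apply` (the entries `(w₀ t w₀⁻¹)₁₀ = 0`, `(w₀ t w₀⁻¹)₀₀ = d₁`).
* §2 **`bigCell_line_dilation_two`** — `∀ x, f(w₀ · n(x) · (n(x_u) t k)) = (χ(d₁) ‖d₁‖_E^z) · f(w₀ · n(Λ(x − (−x_u))) · k)` (THE `hdil` OF PART (b)).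
* §3 `norm_chi_mul_ideleNorm_cpow` (`‖χ(d₁)‖d₁‖^z‖ = ‖d₁‖^{Re z}`), `ideleNorm_torus_one_eq_inv` (`‖d₁‖_E = ‖d₀‖_E⁻¹` on `T(𝔸_F)`), `ideleNorm_lineScalar_eq`
  (`‖Λ‖_F = ‖d₁‖_E`), **`norm_multiplier_eq_rpow`** (`‖m‖ = ‖Λ‖_F^σ` — THE `hm` OF PART (b)).
* §4 **`exists_lineScalar_two`** — `∃ Λ ∈ 𝕀_F, (Λ)_E = d₀⁻¹d₁` (quadratic Galois descent ★ `exists_baseChange_eq_of_conjAdele_eq`).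

HONEST LABEL.  Count-neutral helper; proves no printed statement; HC_CM is proved only modulo the 7 printed citations (2 remaining named inputs: hLiu418 =
`stmt-HodgeConjecture-24832`, h413 = `stmt-HodgeConjecture-24833`) until rung 0 closes.

## References
* [Garrett2018] P. Garrett, *Modern Analysis of Automorphic Forms by Example*, vol. 1 (2018), §2.9.
* [Rogawski1990] J. D. Rogawski, *Automorphic Representations of Unitary Groups in Three Variables* (1990), §1.10 (the torus and `N` of `U(2)`), §2.2.
-/

set_option autoImplicit false
set_option linter.dupNamespace false  -- the mandated namespace repeats the summit's segment (`HodgeConjecture.HodgeConjecture`)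

noncomputable section

open scoped Matrix NNReal
open MeasureTheory NumberField IsDedekindDomain MulAction
open Literature.NumberTheory.Automorphic Literature.NumberTheory.Automorphic.UnitaryGroup Literature.NumberTheory.GaloisRepresentations
open Summit.HodgeConjecture.HodgeConjecture.Cruxes.H413.K2E1BorelEisensteinU

namespace Summit.HodgeConjecture.HodgeConjecture.Cruxes.H413.K2E1BigCellLineDilationU2

variable {F E : Type} [Field F] [NumberField F] [Field E] [NumberField E] [Algebra F E] [Algebra.IsQuadraticExtension F E] {c : E ≃ₐ[F] E}
  (hij : (((0 : Fin 2) : ℕ)) + 1 = ((1 : Fin 2) : ℕ)) (hN : 2 = 2 * ((0 : Fin 2) : ℕ) + 2) {δ : E}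

/-! ## §1 The line chart: additivity, torus conjugation, the long Weyl element -/

/-- **`n(x + x') = n(x) · n(x')`**: the line chart `x ↦ middleRootUnipotent (traceZeroLine x)` is additive-to-multiplicative (★ both maps are homomorphisms).
[cite: Rogawski1990, §1.10] -/
theorem chart_add (hcδ : c δ = -δ) (hδ : δ ≠ 0) (x x' : AdeleRing (𝓞 F) F) :
    ((middleRootUnipotent hij hN (Multiplicative.ofAdd (traceZeroLine F E c hcδ hδ (x + x'))) : ↥(adelicUnipotent F E c 2)) : (quasiSplit F E c 2).Adelic) =
      ((middleRootUnipotent hij hN (Multiplicative.ofAdd (traceZeroLine F E c hcδ hδ x)) : ↥(adelicUnipotent F E c 2)) : (quasiSplit F E c 2).Adelic) *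
        ((middleRootUnipotent hij hN (Multiplicative.ofAdd (traceZeroLine F E c hcδ hδ x')) : ↥(adelicUnipotent F E c 2)) : (quasiSplit F E c 2).Adelic) := by
  rw [map_add, ofAdd_add, map_mul, Subgroup.coe_mul]

/-- **`t⁻¹ · n(x) · t = n(Λ x)`** for `t = diag(d₀, d₁) ∈ T(𝔸_F)` and an idele `Λ` of `F` with `(Λ)_E = d₀⁻¹ d₁` (★ `torusConj_middleRootUnipotent_two`: `t⁻¹ n(b) t =
n((d₀⁻¹d₁) b)`; ★ `traceZeroLine_units_mul`: `θ(Λ x) = (Λ)_E θ(x)`). [cite: Rogawski1990, §1.10] -/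
theorem torus_inv_mul_chart_mul_torus (hcδ : c δ = -δ) (hδ : δ ≠ 0) (t : ↥(torusInBorel F E c 2)) {d : Fin 2 → (AdeleRing (𝓞 E) E)ˣ}
    (hd : glDiagonal 2 (AdeleRing (𝓞 E) E) d = adelicVal F E c 2 _ ((t : borelAdelic F E c 2) : (quasiSplit F E c 2).Adelic))
    (Λ : (AdeleRing (𝓞 F) F)ˣ) (hΛ : ((AdeleRing.ideleBaseChange F E Λ : (AdeleRing (𝓞 E) E)ˣ) : AdeleRing (𝓞 E) E) = (((d 0)⁻¹ * d 1 : (AdeleRing (𝓞 E) E)ˣ) : AdeleRing (𝓞 E) E))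
    (x : AdeleRing (𝓞 F) F) :
    ((t : borelAdelic F E c 2) : (quasiSplit F E c 2).Adelic)⁻¹ *
        ((middleRootUnipotent hij hN (Multiplicative.ofAdd (traceZeroLine F E c hcδ hδ x)) : ↥(adelicUnipotent F E c 2)) : (quasiSplit F E c 2).Adelic) *
        ((t : borelAdelic F E c 2) : (quasiSplit F E c 2).Adelic) =
      ((middleRootUnipotent hij hN (Multiplicative.ofAdd (traceZeroLine F E c hcδ hδ ((Λ : AdeleRing (𝓞 F) F) * x))) : ↥(adelicUnipotent F E c 2)) :
        (quasiSplit F E c 2).Adelic) := by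
  have h := congrArg (fun v : ↥(adelicUnipotent F E c 2) => (v : (quasiSplit F E c 2).Adelic))
    (torusConj_middleRootUnipotent_two hij hN t hd (traceZeroLine F E c hcδ hδ x))
  have hsmul : smulTraceZero ((d 0)⁻¹ * d 1) (conjAdele_lineScalar_two t hd) (traceZeroLine F E c hcδ hδ x) =
      traceZeroLine F E c hcδ hδ ((Λ : AdeleRing (𝓞 F) F) * x) := by
    rw [traceZeroLine_units_mul]
    exact Subtype.ext (by rw [coe_smulTraceZero, coe_smulTraceZero, hΛ])
  rw [hsmul] at h
  exact h

omit [NumberField F] [NumberField E] [Algebra.IsQuadraticExtension F E] in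
/-- `w₀ · w₀ = 1` in `U(J₂)(F)` (`w₀ = antidiag(1, 1)`). [cite: Rogawski1990, §1.10] -/
theorem weylLongU_mul_weylLongU_two :
    weylLongU (c : E →+* E) (rfl : (StdForm.antidiagonal 2).over E = (StdForm.antidiagonal 2).over E) *
        weylLongU (c : E →+* E) (rfl : (StdForm.antidiagonal 2).over E = (StdForm.antidiagonal 2).over E) = 1 := by
  apply Subtype.ext
  apply Units.ext
  change (((weylLongU (c : E →+* E) (rfl : (StdForm.antidiagonal 2).over E = (StdForm.antidiagonal 2).over E) :
        ↥(unitaryGroupOfForm (c : E →+* E) ((StdForm.antidiagonal 2).over E))) : GL (Fin 2) E) : Matrix (Fin 2) (Fin 2) E) *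
      (((weylLongU (c : E →+* E) (rfl : (StdForm.antidiagonal 2).over E = (StdForm.antidiagonal 2).over E) :
        ↥(unitaryGroupOfForm (c : E →+* E) ((StdForm.antidiagonal 2).over E))) : GL (Fin 2) E) : Matrix (Fin 2) (Fin 2) E) = 1
  rw [coe_coe_weylLongU, ← antidiagOne_eq_over (L := E) (N := 2)]
  ext i j; fin_cases i <;> fin_cases j <;> simp [Matrix.mul_apply, Fin.sum_univ_two]

omit [Algebra.IsQuadraticExtension F E] in
/-- `ι(w₀) · ι(w₀) = 1` adelically. [cite: Rogawski1990, §1.10] -/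
theorem toAdelic_weylLongU_mul_self_two :
    (quasiSplit F E c 2).toAdelic (weylLongU (c : E →+* E) (rfl : (StdForm.antidiagonal 2).over E = (StdForm.antidiagonal 2).over E)) *
        (quasiSplit F E c 2).toAdelic (weylLongU (c : E →+* E) (rfl : (StdForm.antidiagonal 2).over E = (StdForm.antidiagonal 2).over E)) = 1 := by
  have h := congrArg (quasiSplit F E c 2).toAdelic (weylLongU_mul_weylLongU_two (F := F) (E := E) (c := c))
  exact (map_mul _ _ _).symm.trans (h.trans (map_one _))

omit [Algebra.IsQuadraticExtension F E] in
/-- The adelic matrix of `ι(w₀)` is `antidiag(1, 1)`: entry `(i, j)` is `1` if `i + j = 1` and `0` otherwise. [cite: Rogawski1990, §1.10] -/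
theorem adelicVal_toAdelic_weylLongU_apply_two (i j : Fin 2) :
    ((adelicVal F E c 2 _ ((quasiSplit F E c 2).toAdelic (weylLongU (c : E →+* E) (rfl : (StdForm.antidiagonal 2).over E = (StdForm.antidiagonal 2).over E))) :
        GL (Fin 2) (AdeleRing (𝓞 E) E)) : Matrix (Fin 2) (Fin 2) (AdeleRing (𝓞 E) E)) i j = if i.val + j.val + 1 = 2 then 1 else 0 := by
  change algebraMap E (AdeleRing (𝓞 E) E) ((((weylLongU (c : E →+* E) (rfl : (StdForm.antidiagonal 2).over E = (StdForm.antidiagonal 2).over E) :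
      ↥(unitaryGroupOfForm (c : E →+* E) ((StdForm.antidiagonal 2).over E))) : GL (Fin 2) E) : Matrix (Fin 2) (Fin 2) E) i j) = _
  rw [coe_coe_weylLongU, ← antidiagOne_eq_over (L := E) (N := 2), Matrix.of_apply]
  split_ifs
  · exact map_one _
  · exact map_zero _

omit [Algebra.IsQuadraticExtension F E] in
/-- **`w₀ t w₀⁻¹ = diag(d₁, d₀)`**, the two entries the section law reads: `(ι(w₀) t ι(w₀))₁₀ = 0` and `(ι(w₀) t ι(w₀))₀₀ = d₁` for `t = diag(d₀, d₁) ∈ T(𝔸_F)`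
(`w₀⁻¹ = w₀`; ★ `adelicVal` currency). [cite: Rogawski1990, §1.10] -/
theorem adelicVal_weylLong_conj_torus_apply (t : ↥(torusInBorel F E c 2)) {d : Fin 2 → (AdeleRing (𝓞 E) E)ˣ}
    (hd : glDiagonal 2 (AdeleRing (𝓞 E) E) d = adelicVal F E c 2 _ ((t : borelAdelic F E c 2) : (quasiSplit F E c 2).Adelic)) :
    ((adelicVal F E c 2 _ (((quasiSplit F E c 2).toAdelic (weylLongU (c : E →+* E) (rfl : (StdForm.antidiagonal 2).over E = (StdForm.antidiagonal 2).over E))) * ((t : borelAdelic F E c 2) : (quasiSplit F E c 2).Adelic) * ((quasiSplit F E c 2).toAdelic (weylLongU (c : E →+* E) (rfl : (StdForm.antidiagonal 2).over E = (StdForm.antidiagonal 2).over E)))) : GL (Fin 2) (AdeleRing (𝓞 E) E)) : Matrix (Fin 2) (Fin 2) (AdeleRing (𝓞 E) E)) 1 0 = 0 ∧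
      ((adelicVal F E c 2 _ (((quasiSplit F E c 2).toAdelic (weylLongU (c : E →+* E) (rfl : (StdForm.antidiagonal 2).over E = (StdForm.antidiagonal 2).over E))) * ((t : borelAdelic F E c 2) : (quasiSplit F E c 2).Adelic) * ((quasiSplit F E c 2).toAdelic (weylLongU (c : E →+* E) (rfl : (StdForm.antidiagonal 2).over E = (StdForm.antidiagonal 2).over E)))) : GL (Fin 2) (AdeleRing (𝓞 E) E)) : Matrix (Fin 2) (Fin 2) (AdeleRing (𝓞 E) E)) 0 0 = d 1 := by
  have hW := adelicVal_toAdelic_weylLongU_apply_two (F := F) (E := E) (c := c)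
  have hT : ∀ i j : Fin 2, ((adelicVal F E c 2 _ ((t : borelAdelic F E c 2) : (quasiSplit F E c 2).Adelic) : GL (Fin 2) (AdeleRing (𝓞 E) E)) : Matrix (Fin 2) (Fin 2) (AdeleRing (𝓞 E) E)) i j =
      if i = j then (d i : AdeleRing (𝓞 E) E) else 0 := fun i j => by
    rw [← hd, coe_glDiagonal, Matrix.diagonal_apply]
  rw [map_mul, map_mul, Units.val_mul, Units.val_mul]
  simp only [Matrix.mul_apply, Fin.sum_univ_two, hW, hT, Fin.val_zero, Fin.val_one, Fin.isValue]
  norm_num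

/-! ## §2 The dilation of the big-cell function along `g = u · t · k` -/

/-- **THE GROUP HALF OF THE DILATION BOUND (`hdil` of part (b)).**  For a Borel section `f` of exponent `z` on `U(J₂)(𝔸_F)` (`f(b g) = χ(b₀₀)‖b₀₀‖_E^z f(g)` for
`b₁₀ = 0`; ★ `flatSectionU_borel_mul_two`), `t = diag(d₀, d₁) ∈ T(𝔸_F)`, an idele `Λ` of `F` with `(Λ)_E = d₀⁻¹ d₁`, `x_u ∈ 𝔸_F` and any `k`:
`f(w₀ · n(x) · (n(x_u) t k)) = χ(d₁)‖d₁‖_E^z · f(w₀ · n(Λ(x − (−x_u))) · k)` for every `x ∈ 𝔸_F` — i.e. `Φ_{n(x_u) t k} = m · Φ_k(Λ(· − y))` with `m = χ(d₁)‖d₁‖_E^z`,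
`y = −x_u`.  (`w₀ n(x) n(x_u) t k = (w₀ t w₀⁻¹)·w₀·(t⁻¹ n(x + x_u) t)·k`, `w₀² = 1`, §1.) [cite: Garrett2018, §2.9] [cite: Rogawski1990, §1.10] -/
theorem bigCell_line_dilation_two (hcδ : c δ = -δ) (hδ : δ ≠ 0) (χ : HeckeCharacter E) (z : ℂ) {f : (quasiSplit F E c 2).Adelic → ℂ}
    (hf : ∀ (b g : (quasiSplit F E c 2).Adelic) (u : (AdeleRing (𝓞 E) E)ˣ),
      ((b.1 : GL (Fin 2) (AdeleRing (𝓞 E) E)) : Matrix (Fin 2) (Fin 2) (AdeleRing (𝓞 E) E)) 1 0 = 0 →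
      (u : (AdeleRing (𝓞 E) E)) = ((b.1 : GL (Fin 2) (AdeleRing (𝓞 E) E)) : Matrix (Fin 2) (Fin 2) (AdeleRing (𝓞 E) E)) 0 0 →
        f (b * g) = ((χ u : ℂˣ) : ℂ) * ((ideleNorm u : ℝ) : ℂ) ^ z * f g)
    (t : ↥(torusInBorel F E c 2)) {d : Fin 2 → (AdeleRing (𝓞 E) E)ˣ}
    (hd : glDiagonal 2 (AdeleRing (𝓞 E) E) d = adelicVal F E c 2 _ ((t : borelAdelic F E c 2) : (quasiSplit F E c 2).Adelic))
    (Λ : (AdeleRing (𝓞 F) F)ˣ) (hΛ : ((AdeleRing.ideleBaseChange F E Λ : (AdeleRing (𝓞 E) E)ˣ) : (AdeleRing (𝓞 E) E)) = (((d 0)⁻¹ * d 1 : (AdeleRing (𝓞 E) E)ˣ) : (AdeleRing (𝓞 E) E)))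
    (xu : (AdeleRing (𝓞 F) F)) (k : (quasiSplit F E c 2).Adelic) (x : (AdeleRing (𝓞 F) F)) :
    f (((quasiSplit F E c 2).toAdelic (weylLongU (c : E →+* E) (rfl : (StdForm.antidiagonal 2).over E = (StdForm.antidiagonal 2).over E))) * ((middleRootUnipotent hij hN (Multiplicative.ofAdd (traceZeroLine F E c hcδ hδ x)) : ↥(adelicUnipotent F E c 2)) : (quasiSplit F E c 2).Adelic) * (((middleRootUnipotent hij hN (Multiplicative.ofAdd (traceZeroLine F E c hcδ hδ xu)) : ↥(adelicUnipotent F E c 2)) : (quasiSplit F E c 2).Adelic) * ((t : borelAdelic F E c 2) : (quasiSplit F E c 2).Adelic) * k)) =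
      (((χ (d 1) : ℂˣ) : ℂ) * ((ideleNorm (d 1) : ℝ) : ℂ) ^ z) * f (((quasiSplit F E c 2).toAdelic (weylLongU (c : E →+* E) (rfl : (StdForm.antidiagonal 2).over E = (StdForm.antidiagonal 2).over E))) * ((middleRootUnipotent hij hN (Multiplicative.ofAdd (traceZeroLine F E c hcδ hδ ((Λ : (AdeleRing (𝓞 F) F)) * (x - -xu)))) : ↥(adelicUnipotent F E c 2)) : (quasiSplit F E c 2).Adelic) * k) := by
  have hn := (chart_add hij hN hcδ hδ x xu).symm
  have hconj := torus_inv_mul_chart_mul_torus hij hN hcδ hδ t hd Λ hΛ (x + xu)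
  have hWW := toAdelic_weylLongU_mul_self_two (F := F) (E := E) (c := c)
  obtain ⟨h10, h00⟩ := adelicVal_weylLong_conj_torus_apply (F := F) (E := E) (c := c) t hd
  have key : ((quasiSplit F E c 2).toAdelic (weylLongU (c : E →+* E) (rfl : (StdForm.antidiagonal 2).over E = (StdForm.antidiagonal 2).over E))) * ((middleRootUnipotent hij hN (Multiplicative.ofAdd (traceZeroLine F E c hcδ hδ x)) : ↥(adelicUnipotent F E c 2)) : (quasiSplit F E c 2).Adelic) * (((middleRootUnipotent hij hN (Multiplicative.ofAdd (traceZeroLine F E c hcδ hδ xu)) : ↥(adelicUnipotent F E c 2)) : (quasiSplit F E c 2).Adelic) * ((t : borelAdelic F E c 2) : (quasiSplit F E c 2).Adelic) * k) =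
      (((quasiSplit F E c 2).toAdelic (weylLongU (c : E →+* E) (rfl : (StdForm.antidiagonal 2).over E = (StdForm.antidiagonal 2).over E))) * ((t : borelAdelic F E c 2) : (quasiSplit F E c 2).Adelic) * ((quasiSplit F E c 2).toAdelic (weylLongU (c : E →+* E) (rfl : (StdForm.antidiagonal 2).over E = (StdForm.antidiagonal 2).over E)))) * (((quasiSplit F E c 2).toAdelic (weylLongU (c : E →+* E) (rfl : (StdForm.antidiagonal 2).over E = (StdForm.antidiagonal 2).over E))) * ((middleRootUnipotent hij hN (Multiplicative.ofAdd (traceZeroLine F E c hcδ hδ ((Λ : (AdeleRing (𝓞 F) F)) * (x + xu)))) : ↥(adelicUnipotent F E c 2)) : (quasiSplit F E c 2).Adelic) * k) := by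
    rw [← hconj, ← hn]
    symm
    calc ((quasiSplit F E c 2).toAdelic (weylLongU (c : E →+* E) (rfl : (StdForm.antidiagonal 2).over E = (StdForm.antidiagonal 2).over E))) * ((t : borelAdelic F E c 2) : (quasiSplit F E c 2).Adelic) * ((quasiSplit F E c 2).toAdelic (weylLongU (c : E →+* E) (rfl : (StdForm.antidiagonal 2).over E = (StdForm.antidiagonal 2).over E))) * (((quasiSplit F E c 2).toAdelic (weylLongU (c : E →+* E) (rfl : (StdForm.antidiagonal 2).over E = (StdForm.antidiagonal 2).over E))) * (((t : borelAdelic F E c 2) : (quasiSplit F E c 2).Adelic)⁻¹ * (((middleRootUnipotent hij hN (Multiplicative.ofAdd (traceZeroLine F E c hcδ hδ x)) : ↥(adelicUnipotent F E c 2)) : (quasiSplit F E c 2).Adelic) * ((middleRootUnipotent hij hN (Multiplicative.ofAdd (traceZeroLine F E c hcδ hδ xu)) : ↥(adelicUnipotent F E c 2)) : (quasiSplit F E c 2).Adelic)) * ((t : borelAdelic F E c 2) : (quasiSplit F E c 2).Adelic)) * k)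
        = ((quasiSplit F E c 2).toAdelic (weylLongU (c : E →+* E) (rfl : (StdForm.antidiagonal 2).over E = (StdForm.antidiagonal 2).over E))) * ((t : borelAdelic F E c 2) : (quasiSplit F E c 2).Adelic) * (((quasiSplit F E c 2).toAdelic (weylLongU (c : E →+* E) (rfl : (StdForm.antidiagonal 2).over E = (StdForm.antidiagonal 2).over E))) * ((quasiSplit F E c 2).toAdelic (weylLongU (c : E →+* E) (rfl : (StdForm.antidiagonal 2).over E = (StdForm.antidiagonal 2).over E)))) * (((t : borelAdelic F E c 2) : (quasiSplit F E c 2).Adelic)⁻¹ * (((middleRootUnipotent hij hN (Multiplicative.ofAdd (traceZeroLine F E c hcδ hδ x)) : ↥(adelicUnipotent F E c 2)) : (quasiSplit F E c 2).Adelic) * ((middleRootUnipotent hij hN (Multiplicative.ofAdd (traceZeroLine F E c hcδ hδ xu)) : ↥(adelicUnipotent F E c 2)) : (quasiSplit F E c 2).Adelic)) * ((t : borelAdelic F E c 2) : (quasiSplit F E c 2).Adelic)) * k := by simp only [mul_assoc]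
      _ = ((quasiSplit F E c 2).toAdelic (weylLongU (c : E →+* E) (rfl : (StdForm.antidiagonal 2).over E = (StdForm.antidiagonal 2).over E))) * ((middleRootUnipotent hij hN (Multiplicative.ofAdd (traceZeroLine F E c hcδ hδ x)) : ↥(adelicUnipotent F E c 2)) : (quasiSplit F E c 2).Adelic) * (((middleRootUnipotent hij hN (Multiplicative.ofAdd (traceZeroLine F E c hcδ hδ xu)) : ↥(adelicUnipotent F E c 2)) : (quasiSplit F E c 2).Adelic) * ((t : borelAdelic F E c 2) : (quasiSplit F E c 2).Adelic) * k) := by rw [hWW, mul_one]; simp only [mul_assoc, mul_inv_cancel_left]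
  rw [key, hf _ _ (d 1) h10 h00.symm, sub_neg_eq_add, mul_assoc]

/-! ## §3 The norm of the multiplier and the norm of the line scalar -/

omit [Algebra.IsQuadraticExtension F E] in
/-- `‖χ(u) · ‖u‖^z‖ = ‖u‖^{Re z}` for a unitary `χ` (★ `HeckeCharacter.IsUnitary`; `‖u‖ > 0`). [folklore] -/
theorem norm_chi_mul_ideleNorm_cpow (χ : HeckeCharacter E) (hχ : χ.IsUnitary) (u : (AdeleRing (𝓞 E) E)ˣ) (z : ℂ) :
    ‖((χ u : ℂˣ) : ℂ) * ((ideleNorm u : ℝ) : ℂ) ^ z‖ = (ideleNorm u) ^ z.re := by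
  have hpos : 0 < ideleNorm u := by
    rw [← coe_ideleNorm]
    exact_mod_cast pos_iff_ne_zero.2 (ideleNorm_ne_zero (K := E) u)
  rw [norm_mul, hχ u, one_mul, Complex.norm_cpow_eq_rpow_re_of_pos hpos]

omit [Algebra.IsQuadraticExtension F E] in
/-- **On the torus of `U(J₂)`: `‖d₁‖_E = ‖d₀‖_E⁻¹`** (`c(d₁) d₀ = 1`, ★ `torus_relations_two`, and the `Aut(E/F)`-invariance of the idele norm ★ `ideleNorm_galSmul`).
[cite: Rogawski1990, §1.10] -/
theorem ideleNorm_torus_one_eq_inv (t : ↥(torusInBorel F E c 2)) {d : Fin 2 → (AdeleRing (𝓞 E) E)ˣ}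
    (hd : glDiagonal 2 (AdeleRing (𝓞 E) E) d = adelicVal F E c 2 _ ((t : borelAdelic F E c 2) : (quasiSplit F E c 2).Adelic)) :
    IdeleClassGroup.ideleNorm E (d 1) = (IdeleClassGroup.ideleNorm E (d 0))⁻¹ := by
  obtain ⟨h10, -⟩ := torus_relations_two t hd
  have hunit : (Units.map (MulSemiringAction.toRingHom (E ≃ₐ[F] E) (AdeleRing (𝓞 E) E) c : _ →* _) (d 1)) * d 0 = 1 := by
    ext
    rw [Units.val_mul, Units.coe_map, MonoidHom.coe_coe, MulSemiringAction.toRingHom_apply, Units.val_one, ← conjAdele_apply]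
    exact h10
  apply eq_inv_of_mul_eq_one_left
  rw [← UnitaryGroup.ideleNorm_galSmul c (d 1), ← map_mul, hunit, map_one]

/-- **`‖Λ‖_F = ‖d₁‖_E`** for the line scalar: `(Λ)_E = d₀⁻¹ d₁` has `E`-norm `‖d₀‖⁻¹‖d₁‖ = ‖d₁‖²`, and `‖(Λ)_E‖_E = ‖Λ‖_F²` (★ `ideleNorm_ideleBaseChange`, `[E:F] = 2`).
[cite: Rogawski1990, §1.10] -/
theorem ideleNorm_lineScalar_eq (t : ↥(torusInBorel F E c 2)) {d : Fin 2 → (AdeleRing (𝓞 E) E)ˣ}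
    (hd : glDiagonal 2 (AdeleRing (𝓞 E) E) d = adelicVal F E c 2 _ ((t : borelAdelic F E c 2) : (quasiSplit F E c 2).Adelic))
    (Λ : (AdeleRing (𝓞 F) F)ˣ) (hΛ : ((AdeleRing.ideleBaseChange F E Λ : (AdeleRing (𝓞 E) E)ˣ) : (AdeleRing (𝓞 E) E)) = (((d 0)⁻¹ * d 1 : (AdeleRing (𝓞 E) E)ˣ) : (AdeleRing (𝓞 E) E))) :
    IdeleClassGroup.ideleNorm F Λ = IdeleClassGroup.ideleNorm E (d 1) := by
  have hΛ' : AdeleRing.ideleBaseChange F E Λ = (d 0)⁻¹ * d 1 := Units.ext hΛ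
  have h := Literature.NumberTheory.AdelicBaseChange.ideleNorm_ideleBaseChange (K := F) (L := E) Λ
  rw [hΛ', map_mul, map_inv, ← ideleNorm_torus_one_eq_inv t hd, Algebra.IsQuadraticExtension.finrank_eq_two F E, ← sq] at h
  exact ((pow_left_inj₀ zero_le zero_le two_ne_zero).1 h).symm

/-- **`‖m‖ = ‖Λ‖_F^σ`** for `m = χ(d₁)‖d₁‖_E^z`, `σ = Re z` — the hypothesis `hm` of part (b) `norm_sub_borelConstantTerm_le_rpow_two`. [cite: Garrett2018, §2.9] -/
theorem norm_multiplier_eq_rpow (χ : HeckeCharacter E) (hχ : χ.IsUnitary) (z : ℂ) (t : ↥(torusInBorel F E c 2)) {d : Fin 2 → (AdeleRing (𝓞 E) E)ˣ}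
    (hd : glDiagonal 2 (AdeleRing (𝓞 E) E) d = adelicVal F E c 2 _ ((t : borelAdelic F E c 2) : (quasiSplit F E c 2).Adelic))
    (Λ : (AdeleRing (𝓞 F) F)ˣ) (hΛ : ((AdeleRing.ideleBaseChange F E Λ : (AdeleRing (𝓞 E) E)ˣ) : (AdeleRing (𝓞 E) E)) = (((d 0)⁻¹ * d 1 : (AdeleRing (𝓞 E) E)ˣ) : (AdeleRing (𝓞 E) E))) :
    ‖((χ (d 1) : ℂˣ) : ℂ) * ((ideleNorm (d 1) : ℝ) : ℂ) ^ z‖ = ((IdeleClassGroup.ideleNorm F Λ : ℝ≥0) : ℝ) ^ z.re := by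
  rw [norm_chi_mul_ideleNorm_cpow χ hχ, ideleNorm_lineScalar_eq t hd Λ hΛ, coe_ideleNorm]

/-! ## §4 The line scalar exists: `Λ ∈ 𝕀_F` with `(Λ)_E = d₀⁻¹ d₁` -/

/-- **THE LINE SCALAR IS AN IDELE OF `F`**: for `t = diag(d₀, d₁) ∈ T(𝔸_F)` there is `Λ ∈ 𝕀_F` with `(Λ)_E = d₀⁻¹ d₁` (the scalar is `c ⊗ 1`-fixed, ★
`conjAdele_lineScalar_two`; quadratic Galois descent ★ `exists_baseChange_eq_of_conjAdele_eq` for it and for its inverse; ★ `AdeleRing.baseChange_injective`).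
It is `N_{E/F}(d₀)⁻¹`. [cite: Rogawski1990, §1.10] [cite: CasselsFrohlichANT1967, Ch. II §14] -/
theorem exists_lineScalar_two (hcδ : c δ = -δ) (hδ : δ ≠ 0) (t : ↥(torusInBorel F E c 2)) {d : Fin 2 → (AdeleRing (𝓞 E) E)ˣ}
    (hd : glDiagonal 2 (AdeleRing (𝓞 E) E) d = adelicVal F E c 2 _ ((t : borelAdelic F E c 2) : (quasiSplit F E c 2).Adelic)) :
    ∃ Λ : (AdeleRing (𝓞 F) F)ˣ, ((AdeleRing.ideleBaseChange F E Λ : (AdeleRing (𝓞 E) E)ˣ) : (AdeleRing (𝓞 E) E)) = (((d 0)⁻¹ * d 1 : (AdeleRing (𝓞 E) E)ˣ) : (AdeleRing (𝓞 E) E)) := by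
  have hx := conjAdele_lineScalar_two t hd
  have hx' : conjAdele F E c ((((d 0)⁻¹ * d 1 : (AdeleRing (𝓞 E) E)ˣ)⁻¹ : (AdeleRing (𝓞 E) E)ˣ) : (AdeleRing (𝓞 E) E)) = ((((d 0)⁻¹ * d 1 : (AdeleRing (𝓞 E) E)ˣ)⁻¹ : (AdeleRing (𝓞 E) E)ˣ) : (AdeleRing (𝓞 E) E)) := by
    have h1 : conjAdele F E c ((((d 0)⁻¹ * d 1 : (AdeleRing (𝓞 E) E)ˣ)⁻¹ : (AdeleRing (𝓞 E) E)ˣ) : (AdeleRing (𝓞 E) E)) * (((d 0)⁻¹ * d 1 : (AdeleRing (𝓞 E) E)ˣ) : (AdeleRing (𝓞 E) E)) = 1 := by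
      conv_lhs => rw [← hx]
      rw [← map_mul, Units.inv_mul, map_one]
    exact Units.eq_inv_of_mul_eq_one_right h1
  obtain ⟨a, ha⟩ := UnitaryGroup.exists_baseChange_eq_of_conjAdele_eq E c hcδ hδ hx
  obtain ⟨a', ha'⟩ := UnitaryGroup.exists_baseChange_eq_of_conjAdele_eq E c hcδ hδ hx'
  have haa' : a * a' = 1 := AdeleRing.baseChange_injective F E (by rw [map_mul, ha, ha', Units.mul_inv, map_one])
  have ha'a : a' * a = 1 := by rw [mul_comm]; exact haa'
  exact ⟨⟨a, a', haa', ha'a⟩, by rw [AdeleRing.coe_ideleBaseChange]; exact ha⟩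

end Summit.HodgeConjecture.HodgeConjecture.Cruxes.H413.K2E1BigCellLineDilationU2

end
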